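import Mathlib.Analysis.Matrix.Normed
import Mathlib.Analysis.Calculus.FDeriv.Mul
import Mathlib.Analysis.Calculus.Deriv.Mul
import Mathlib.Analysis.Calculus.Deriv.Pow
import Mathlib.Analysis.Calculus.Deriv.Polynomial
import Mathlib.Analysis.Complex.RealDeriv
import Mathlib.LinearAlgebra.Matrix.Charpoly.Coeff
import Mathlib.LinearAlgebra.Matrix.NonsingularInverse
import HarnessLib

/-!
# Stub `stub_matrix_affine_path_calculus` of line `pin-the-infimum` (crux `RobustYangMillsHandover`, 8892)

E2, layer α3b of the fermionic-insertion bricks in Lüscher's transfer-matrix representation of the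
QCD torus functional. A quark-bilinear source `s` perturbs one diagonal block of the time-sliced
Wilson–Dirac matrix, so that the chain block becomes the AFFINE matrix path `E(s) = E - s K`
(`E` invertible), and Lüscher's formula `det D = ∏ₜ det Eₜ · det (1 - ∏ₜ Eₜ⁻¹Fₜ)` has to be
differentiated at `s = 0`. This file supplies the three generic calculus facts about such a path
(complex `n × n` matrices, real parameter `s`, everything at `s = 0`):

* (i) `d/ds (E - sK)⁻¹ᵢⱼ |₀ = (E⁻¹ K E⁻¹)ᵢⱼ` — the derivative of the inverse,
  `d(X⁻¹) = -X⁻¹ (dX) X⁻¹` with `dX = -K`;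
* (ii) `d/ds det (E - sK) |₀ = -det E · tr (E⁻¹K)` — Jacobi's formula;
* (iii) `det (E - sK)` is a unit (`≠ 0`) for all `s` near `0`.

## Proof

(ii): `E - zK = E (1 + z (-(E⁻¹K)))`, `det` is multiplicative, and Mathlib's Taylor expansion
`Matrix.det_one_add_smul` (`det (1 + z M) = 1 + tr M · z + q(z) z²`, `q` a polynomial) gives
`d/dz det (1 + zM)|₀ = tr M` (adapted from the tree's real version
`Literature.Analysis.Calculus.hasDerivAt_det_one_add_smul` in `JacobiFormula.lean`); the real
parameter is restored with `HasDerivAt.comp_ofReal`. (iii): the determinant along the path is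
continuous (it is differentiable by (ii)) and nonzero at `0`. (i): in the Banach algebra
`Matrix n n ℂ` with the (scoped) `L∞` operator norm `Matrix.Norms.Operator`, Mathlib's
`hasFDerivAt_ringInverse` (`D(x ↦ x⁻¹)(u) t = -u⁻¹ t u⁻¹`) composed with the affine path
(derivative `-K`) gives `d/dz (E - zK)⁻¹ |₀ = E⁻¹ K E⁻¹`; the entry `(i, j)` is a continuous linear
functional, and again `HasDerivAt.comp_ofReal` passes to the real parameter. The statements are
entrywise / scalar, so no matrix norm appears in them.

References: R. A. Horn, C. R. Johnson, *Matrix Analysis*, 2nd ed. (CUP 2013), §0.8.10 (Jacobi's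
formula) and §5.6–§5.8 (continuity/differentiability of the inverse); J. R. Magnus, H. Neudecker,
*Matrix Differential Calculus*, 3rd ed. (Wiley 2019), Ch. 8, Thm. 8.1 and §8.4.
-/

open Matrix

namespace Summit.QuantumFields.QCD.Cruxes.RobustYangMillsHandover.PinTheInfimum

namespace StubMatrixAffinePathCalculus

variable {n : Type*} [Fintype n] [DecidableEq n]

/-- **`d/dz det (1 + z M)|_{z = 0} = tr M`** for a complex square matrix `M` (from Mathlib's
expansion `det (1 + z M) = 1 + tr M · z + q(z) z²`, `Matrix.det_one_add_smul`). [folklore] -/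
theorem hasDerivAt_det_one_add_smul (M : Matrix n n ℂ) :
    HasDerivAt (fun z : ℂ => (1 + z • M).det) M.trace 0 := by
  -- adapted from Literature/Analysis/Calculus/JacobiFormula.lean (`hasDerivAt_det_one_add_smul`,
  -- the same statement over `ℝ`)
  set P := (1 + (Polynomial.X : Polynomial ℂ) • M.map Polynomial.C).det.divX.divX
  have hfun : (fun z : ℂ => (1 + z • M).det) =
      fun z => 1 + M.trace * z + Polynomial.eval z P * z ^ 2 := by
    funext z
    rw [Matrix.det_one_add_smul z M]
  rw [hfun]
  have h1 : HasDerivAt (fun z : ℂ => 1 + M.trace * z) M.trace 0 := by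
    refine (((hasDerivAt_id (0 : ℂ)).const_mul M.trace).const_add 1).congr_deriv ?_
    simp
  have h2 : HasDerivAt (fun z : ℂ => Polynomial.eval z P * z ^ 2) 0 0 := by
    refine ((P.hasDerivAt 0).mul (hasDerivAt_pow 2 (0 : ℂ))).congr_deriv ?_
    simp
  exact (h1.add h2).congr_deriv (add_zero _)

/-- For invertible `E` the affine path factorises through `E`:
`E - z K = E (1 + z (-(E⁻¹ K)))`. [folklore] -/
theorem sub_smul_eq_mul_one_add_smul {E : Matrix n n ℂ} (K : Matrix n n ℂ) (hE : IsUnit E.det)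
    (z : ℂ) : E - z • K = E * (1 + z • (-(E⁻¹ * K))) := by
  rw [Matrix.mul_add, Matrix.mul_one, Matrix.mul_smul, Matrix.mul_neg,
    Matrix.mul_nonsing_inv_cancel_left _ _ hE, smul_neg, sub_eq_add_neg]

/-- **Jacobi's formula along the affine path, complex parameter**: for invertible `E`,
`d/dz det (E - z K)|_{z = 0} = -det E · tr (E⁻¹ K)` (`det (E - zK) = det E · det (1 - z E⁻¹K)` and
`hasDerivAt_det_one_add_smul`). [folklore] -/
theorem hasDerivAt_det_sub_smul_complex {E : Matrix n n ℂ} (K : Matrix n n ℂ)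
    (hE : IsUnit E.det) :
    HasDerivAt (fun z : ℂ => (E - z • K).det) (-(E.det * (E⁻¹ * K).trace)) 0 := by
  have hfun : (fun z : ℂ => (E - z • K).det) =
      fun z => E.det * (1 + z • (-(E⁻¹ * K))).det := by
    funext z
    rw [sub_smul_eq_mul_one_add_smul K hE z, Matrix.det_mul]
  rw [hfun]
  have h := (hasDerivAt_det_one_add_smul (-(E⁻¹ * K))).const_mul E.det
  rw [Matrix.trace_neg, mul_neg] at h
  exact h

/-- **(ii) Jacobi's formula along the affine path, real parameter**: for invertible `E`,
`d/ds det (E - s K)|_{s = 0} = -det E · tr (E⁻¹ K)` (`s : ℝ` coerced to `ℂ`). [folklore] -/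
theorem hasDerivAt_det_sub_smul {E : Matrix n n ℂ} (K : Matrix n n ℂ) (hE : IsUnit E.det) :
    HasDerivAt (fun s : ℝ => (E - (s : ℂ) • K).det) (-(E.det * (E⁻¹ * K).trace)) 0 := by
  have h := hasDerivAt_det_sub_smul_complex K hE
  rw [← Complex.ofReal_zero] at h
  exact h.comp_ofReal

/-- **(iii) The affine path stays invertible near `0`**: for invertible `E`, `det (E - s K)` is a
unit for all real `s` in a neighbourhood of `0` (the determinant is continuous along the path and
nonzero at `s = 0`). [folklore] -/
theorem eventually_isUnit_det_sub_smul {E : Matrix n n ℂ} (K : Matrix n n ℂ)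
    (hE : IsUnit E.det) : ∀ᶠ s : ℝ in nhds 0, IsUnit (E - (s : ℂ) • K).det := by
  have h0 : (E - ((0 : ℝ) : ℂ) • K).det ≠ 0 := by
    rw [Complex.ofReal_zero, zero_smul, sub_zero]
    exact hE.ne_zero
  exact ((hasDerivAt_det_sub_smul K hE).continuousAt.eventually_ne h0).mono
    fun s hs => isUnit_iff_ne_zero.mpr hs

open scoped Matrix.Norms.Operator in
/-- **The derivative of the inverse along the affine path, complex parameter**: for invertible
`E`, every entry of `z ↦ (E - z K)⁻¹` is differentiable at `z = 0` with derivative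
`(E⁻¹ K E⁻¹)ᵢⱼ` (Mathlib's `hasFDerivAt_ringInverse`, `D(x ↦ x⁻¹)(u) t = -u⁻¹ t u⁻¹`, in the
Banach algebra `Matrix n n ℂ` with the `L∞` operator norm, composed with the path, whose derivative
is `-K`, and with the entry functional). [folklore] -/
theorem hasDerivAt_inv_sub_smul_apply_complex {E : Matrix n n ℂ} (K : Matrix n n ℂ)
    (hE : IsUnit E.det) (i j : n) :
    HasDerivAt (fun z : ℂ => (E - z • K)⁻¹ i j) ((E⁻¹ * K * E⁻¹) i j) 0 := by
  obtain ⟨u, hu⟩ := (Matrix.isUnit_iff_isUnit_det E).mpr hE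
  -- the affine path and its derivative
  have hlin : HasDerivAt (fun z : ℂ => E - z • K) (-K) 0 := by
    have h := ((hasDerivAt_id' (0 : ℂ)).smul_const K).const_sub E
    rw [one_smul] at h
    exact h
  -- the inverse along the path
  have hinv : HasDerivAt (fun z : ℂ => (E - z • K)⁻¹) (E⁻¹ * K * E⁻¹) 0 := by
    have h := (hasFDerivAt_ringInverse (𝕜 := ℂ) u).comp_hasDerivAt_of_eq (0 : ℂ) hlin
      (by simp [hu])
    have hfun : (Ring.inverse ∘ fun z : ℂ => E - z • K) = fun z : ℂ => (E - z • K)⁻¹ := by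
      funext z
      simp [Matrix.nonsing_inv_eq_ringInverse]
    rw [hfun] at h
    refine h.congr_deriv ?_
    simp [ContinuousLinearMap.mulLeftRight_apply, Matrix.coe_units_inv, hu]
  -- the entry `(i, j)`
  have h := (LinearMap.toContinuousLinearMap (Matrix.entryLinearMap ℂ ℂ i j)).hasFDerivAt
    |>.comp_hasDerivAt (0 : ℂ) hinv
  simp only [Function.comp_def, LinearMap.coe_toContinuousLinearMap',
    Matrix.entryLinearMap_apply] at h
  exact h

/-- **(i) The derivative of the inverse along the affine path, real parameter**: for invertible
`E`, `d/ds (E - s K)⁻¹ᵢⱼ |_{s = 0} = (E⁻¹ K E⁻¹)ᵢⱼ` (`s : ℝ` coerced to `ℂ`). [folklore] -/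
theorem hasDerivAt_inv_sub_smul_apply {E : Matrix n n ℂ} (K : Matrix n n ℂ) (hE : IsUnit E.det)
    (i j : n) :
    HasDerivAt (fun s : ℝ => (E - (s : ℂ) • K)⁻¹ i j) ((E⁻¹ * K * E⁻¹) i j) 0 := by
  have h := hasDerivAt_inv_sub_smul_apply_complex K hE i j
  rw [← Complex.ofReal_zero] at h
  exact h.comp_ofReal

end StubMatrixAffinePathCalculus

/-- **E2 α3b: calculus of the affine matrix path `s ↦ E - s K` at `s = 0`** (complex `n × n`
matrices, `E` invertible, real parameter): (i) every entry of the inverse is differentiable with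
`d/ds (E - sK)⁻¹ᵢⱼ |₀ = (E⁻¹ K E⁻¹)ᵢⱼ`; (ii) Jacobi's formula
`d/ds det (E - sK) |₀ = -det E · tr (E⁻¹ K)`; (iii) `det (E - sK)` is a unit for all `s` near `0`
— the three generic facts needed to differentiate Lüscher's factorisation
`det D = ∏ₜ det Eₜ · det (1 - ∏ₜ Eₜ⁻¹Fₜ)` with respect to a source in one chain block
(Horn–Johnson, *Matrix Analysis*, §0.8.10; Magnus–Neudecker, *Matrix Differential Calculus*,
Ch. 8). The statement is the registered stub signature verbatim. [folklore] -/
theorem stub_matrix_affine_path_calculus :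
    ∀ (n : Type) [Fintype n] [DecidableEq n] (E K : Matrix n n ℂ), IsUnit E.det →
      (∀ i j, HasDerivAt (fun s : ℝ => (E - (s : ℂ) • K)⁻¹ i j) ((E⁻¹ * K * E⁻¹) i j) 0) ∧
      HasDerivAt (fun s : ℝ => (E - (s : ℂ) • K).det) (-(E.det * (E⁻¹ * K).trace)) 0 ∧
      (∀ᶠ s : ℝ in nhds 0, IsUnit (E - (s : ℂ) • K).det) := by
  intro n _ _ E K hE
  exact ⟨fun i j => StubMatrixAffinePathCalculus.hasDerivAt_inv_sub_smul_apply K hE i j,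
    StubMatrixAffinePathCalculus.hasDerivAt_det_sub_smul K hE,
    StubMatrixAffinePathCalculus.eventually_isUnit_det_sub_smul K hE⟩

end Summit.QuantumFields.QCD.Cruxes.RobustYangMillsHandover.PinTheInfimum
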